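import Literature.NumberTheory.EllipticCurves.SerreOpenImageNormalizerCaseProofs
import Literature.NumberTheory.GaloisRepresentations.SerreCartanNormalizerGL2Fp
import HarnessLib

/-!
# Route `ErratumRoadFive` (rung K2), crux `NonSurjCorner` (item stmt-BirchSwinnertonDyer-19065), line `Lines/hybrid.lean`, r22 slot 6″, step (L1),
# input (T): the TRACE PROPERTY of a split-Cartan-normaliser image — the determinant-one part of `N(C_s)` is trace-orthogonal to no element of `N(C_s)`
# (cell `bsd-stepL`, seat `bsd-stepL-corner-p1` g18; `--supports stmt-BirchSwinnertonDyer-19065 --as helper`)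

WHY THIS FILE. `AuxPrimeSupplyCorner.exists_preWitness_of_rangeK` (this seat) builds the Frobenius pre-witness of road B at an image of order prime
to `p` from two properties of the image group: (K) K-disjointness and (T) «for every `g ∈ Γ_ℚ` some `σ₀` with `det ρ̄(σ₀) = 1` has
`tr ρ̄(g σ₀) ≠ 0`». This file proves (T) when the mod-`p` image is the FULL NORMALISER OF A SPLIT CARTAN subgroup (`p ≥ 5`) — the image of
every corner pair at `p ≥ 7` and of the `5Ns` corner pairs at `5` (lane B's `image_eq_normalizer_splitCartan`,
`CornerShape.NonSurjCorner.image_five_eq_normalizer_or_eq_G9`). In the Cartan frame `P`, `ρ̄(g)` is diagonal `diag(u,v)` or antidiagonal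
`(0 x; y 0)`; take `σ₀` with `ρ̄(σ₀) = P diag(a, a⁻¹) P⁻¹` resp. `P (0 a; −a⁻¹ 0) P⁻¹` (elements of `N(C_s)`, determinant `1`): the traces are
`u a + v a⁻¹` resp. `y a − x a⁻¹`, and `a ∈ {1, 2}` cannot both give `0` (else `3u = 0` resp. `3y = 0`, contradicting `det ≠ 0`; `p ∤ 6`).
* `AuxPrimeSupplyCorner.traceProperty_of_image_eq_normalizer_splitCartan`.
The `G₉` (`5S4`) case of (T) is a finite check on Zywina's group, left to lane B's `Quad` machinery.

HONEST FRAMING: ONE THEOREM (no definition, no named fact, no `sorry`); pure group theory on the image; nothing about any curve's BSD; 19065 NOT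
closed; BSD is not advanced; T7.
References (locators only): [cite: Serre1972, §2.2] [cite: Zywina2015, Thm. 1.4, Thm. 1.5] [cite: GrossLMS1991, §3 (p. 239)].
-/

noncomputable section

set_option autoImplicit false
set_option linter.dupNamespace false -- `Summit.BirchSwinnertonDyer.BirchSwinnertonDyer` (summit = problem), tree-wide

open scoped Classical MatrixGroups
open WeierstrassCurve Field Matrix
open Literature.NumberTheory.GaloisRepresentations Literature.NumberTheory.EllipticCurves
open Literature.NumberTheory.GaloisRepresentations.Serre1972

namespace Summit.BirchSwinnertonDyer.BirchSwinnertonDyer.Theorems.AuxPrimeSupplyCorner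

/-- **(T) for a split-Cartan-normaliser image (`p ≥ 5`).** If `Φ(ρ̄_{E,p}(Γ_ℚ)) = N(P (* 0; 0 *) P⁻¹)`, then for every `g ∈ Γ_ℚ` some
`σ₀ ∈ Γ_ℚ` with `det Φ(ρ̄ σ₀) = 1` has `tr Φ(ρ̄(g σ₀)) ≠ 0`. [cite: Serre1972, §2.2] -/
theorem traceProperty_of_image_eq_normalizer_splitCartan (W : WeierstrassCurve ℚ) [W.IsElliptic] {p : ℕ} [Fact p.Prime]
    (hp5 : 5 ≤ p) (Φ : Multiplicative (AddAut (geomTorsion W p)) ≃* GL (Fin 2) (ZMod p)) {P : GL (Fin 2) (ZMod p)}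
    (hG : (galoisRepTorsion W p).range.map Φ.toMonoidHom = Subgroup.normalizer (splitCartan P : Set (GL (Fin 2) (ZMod p)))) :
    ∀ g : absoluteGaloisGroup ℚ, ∃ σ₀ : absoluteGaloisGroup ℚ,
      Matrix.GeneralLinearGroup.det (Φ (galoisRepTorsion W p σ₀)) = 1 ∧
      Matrix.trace ((Φ (galoisRepTorsion W p (g * σ₀)) : GL (Fin 2) (ZMod p)) : Matrix (Fin 2) (Fin 2) (ZMod p)) ≠ 0 := by
  intro g
  have hp : p.Prime := Fact.out
  have hp2 : p ≠ 2 := by omega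
  have h2 : (2 : ZMod p) ≠ 0 := by
    intro h
    have := (CharP.cast_eq_zero_iff (ZMod p) p 2).mp (by exact_mod_cast h)
    have := Nat.le_of_dvd (by norm_num) this
    omega
  have h3 : (3 : ZMod p) ≠ 0 := by
    intro h
    have := (CharP.cast_eq_zero_iff (ZMod p) p 3).mp (by exact_mod_cast h)
    have := Nat.le_of_dvd (by norm_num) this
    omega
  obtain ⟨b, hb⟩ : ∃ b : ZMod p, 2 * b = 1 := ⟨(2 : ZMod p)⁻¹, mul_inv_cancel₀ h2⟩
  have hF : ∃ u : (ZMod p)ˣ, u ≠ 1 := exists_units_ne_one hp2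
  set ρ := galoisRepTorsion W p with hρ
  set X : GL (Fin 2) (ZMod p) := Φ (ρ g) with hX
  have hXG : X ∈ Subgroup.normalizer (splitCartan P : Set (GL (Fin 2) (ZMod p))) := by
    rw [← hG]; exact apply_galoisRepTorsion_mem_map_range W p Φ g
  set Xc : GL (Fin 2) (ZMod p) := P⁻¹ * X * P with hXc
  clear_value Xc X
  -- trace is conjugation invariant
  have htrconj : ∀ M : GL (Fin 2) (ZMod p),
      Matrix.trace ((P * M * P⁻¹ : GL (Fin 2) (ZMod p)) : Matrix (Fin 2) (Fin 2) (ZMod p)) =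
        Matrix.trace (M : Matrix (Fin 2) (Fin 2) (ZMod p)) := fun M ↦ by
    rw [Units.val_mul, Units.val_mul, Matrix.trace_mul_cycle, ← Units.val_mul, inv_mul_cancel, Units.val_one, Matrix.one_mul]
  -- the key reduction: a test element `Y` (diagonal or antidiagonal, determinant one) with `tr (Xc Y) ≠ 0` suffices
  have key : ∀ Y : GL (Fin 2) (ZMod p),
      (GL2.IsDg ((Y : GL (Fin 2) (ZMod p)) : Matrix (Fin 2) (Fin 2) (ZMod p)) ∨
        GL2.IsAd ((Y : GL (Fin 2) (ZMod p)) : Matrix (Fin 2) (Fin 2) (ZMod p))) →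
      Matrix.GeneralLinearGroup.det Y = 1 →
      Matrix.trace ((Xc * Y : GL (Fin 2) (ZMod p)) : Matrix (Fin 2) (Fin 2) (ZMod p)) ≠ 0 →
      ∃ σ₀ : absoluteGaloisGroup ℚ, Matrix.GeneralLinearGroup.det (Φ (ρ σ₀)) = 1 ∧
        Matrix.trace ((Φ (ρ (g * σ₀)) : GL (Fin 2) (ZMod p)) : Matrix (Fin 2) (Fin 2) (ZMod p)) ≠ 0 := by
    intro Y hY hdetY htrY
    have hN : P * Y * P⁻¹ ∈ Subgroup.normalizer (splitCartan P : Set (GL (Fin 2) (ZMod p))) := by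
      rw [mem_normalizer_splitCartan_iff hF]
      have : P⁻¹ * (P * Y * P⁻¹) * P = Y := by group
      rw [this]
      exact hY
    rw [← hG] at hN
    obtain ⟨σ₀, hσ₀⟩ := (mem_map_range_galoisRepTorsion_iff W p Φ).mp hN
    refine ⟨σ₀, ?_, ?_⟩
    · rw [hσ₀, map_mul, map_mul, map_inv, mul_inv_cancel_comm, hdetY]
    · rw [map_mul, map_mul, hσ₀, ← hX]
      have : X * (P * Y * P⁻¹) = P * (Xc * Y) * P⁻¹ := by rw [hXc]; group
      rw [this, htrconj]
      exact htrY
  rcases (mem_normalizer_splitCartan_iff hF).mp hXG with hDg | hAd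
  · -- `Xc = diag(u, v)`, `u v ≠ 0`
    have hdet : (Xc : Matrix (Fin 2) (Fin 2) (ZMod p)).det ≠ 0 := GL2.det_ne_zero Xc
    rw [← hXc] at hDg
    rw [GL2.det_of_isDg hDg] at hdet
    obtain ⟨hX01, hX10⟩ := hDg
    by_cases h1 : (Xc : Matrix (Fin 2) (Fin 2) (ZMod p)) 0 0 + (Xc : Matrix (Fin 2) (Fin 2) (ZMod p)) 1 1 = 0
    · -- test element `diag(2, 2⁻¹)`
      obtain ⟨Y, hYval⟩ : ∃ Y : GL (Fin 2) (ZMod p),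
          (Y : Matrix (Fin 2) (Fin 2) (ZMod p)) = !![(2 : ZMod p), 0; 0, b] :=
        ⟨Matrix.GeneralLinearGroup.mkOfDetNeZero _ (by rw [Matrix.det_fin_two_of]; intro h; apply one_ne_zero (α := ZMod p); linear_combination h - hb), rfl⟩
      refine key Y (Or.inl ⟨by simp [hYval], by simp [hYval]⟩) ?_ ?_
      · ext
        rw [Matrix.GeneralLinearGroup.val_det_apply, hYval, Matrix.det_fin_two_of, Units.val_one]
        linear_combination hb
      · rw [Units.val_mul]
        simp only [Matrix.trace_fin_two, Matrix.mul_apply, Fin.sum_univ_two, hYval, Matrix.of_apply, Matrix.cons_val_zero,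
          Matrix.cons_val_one, hX01, hX10]
        intro h
        have hu0 : (3 : ZMod p) * (Xc : Matrix (Fin 2) (Fin 2) (ZMod p)) 0 0 = 0 := by
          linear_combination (2 : ZMod p) * h - (Xc : Matrix (Fin 2) (Fin 2) (ZMod p)) 1 1 * hb - h1
        rcases mul_eq_zero.mp hu0 with h3' | hu0'
        · exact h3 h3'
        · apply hdet; rw [hu0', zero_mul]
    · -- test element `1`
      refine key 1 (Or.inl ⟨by simp, by simp⟩) (map_one _) ?_
      rw [mul_one, Matrix.trace_fin_two]
      exact h1
  · -- `Xc = (0 x; y 0)`, `x y ≠ 0`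
    have hdet : (Xc : Matrix (Fin 2) (Fin 2) (ZMod p)).det ≠ 0 := GL2.det_ne_zero Xc
    rw [← hXc] at hAd
    rw [GL2.det_of_isAd hAd, neg_ne_zero] at hdet
    obtain ⟨hX00, hX11⟩ := hAd
    by_cases h1 : (Xc : Matrix (Fin 2) (Fin 2) (ZMod p)) 1 0 - (Xc : Matrix (Fin 2) (Fin 2) (ZMod p)) 0 1 = 0
    · -- test element `(0 2; -2⁻¹ 0)`
      obtain ⟨Y, hYval⟩ : ∃ Y : GL (Fin 2) (ZMod p),
          (Y : Matrix (Fin 2) (Fin 2) (ZMod p)) = !![0, (2 : ZMod p); -b, 0] :=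
        ⟨Matrix.GeneralLinearGroup.mkOfDetNeZero _ (by rw [Matrix.det_fin_two_of]; intro h; apply one_ne_zero (α := ZMod p); linear_combination h - hb), rfl⟩
      refine key Y (Or.inr ⟨by simp [hYval], by simp [hYval]⟩) ?_ ?_
      · ext
        rw [Matrix.GeneralLinearGroup.val_det_apply, hYval, Matrix.det_fin_two_of, Units.val_one]
        linear_combination hb
      · rw [Units.val_mul]
        simp only [Matrix.trace_fin_two, Matrix.mul_apply, Fin.sum_univ_two, hYval, Matrix.of_apply, Matrix.cons_val_zero,
          Matrix.cons_val_one, hX00, hX11]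
        intro h
        have hy0 : (3 : ZMod p) * (Xc : Matrix (Fin 2) (Fin 2) (ZMod p)) 1 0 = 0 := by
          linear_combination (2 : ZMod p) * h + (Xc : Matrix (Fin 2) (Fin 2) (ZMod p)) 0 1 * hb - h1
        rcases mul_eq_zero.mp hy0 with h3' | hy0'
        · exact h3 h3'
        · apply hdet
          have hx0 : (Xc : Matrix (Fin 2) (Fin 2) (ZMod p)) 0 1 = 0 := by linear_combination hy0' - h1
          rw [hx0, zero_mul]
    · -- test element `(0 1; -1 0)`
      obtain ⟨Y, hYval⟩ : ∃ Y : GL (Fin 2) (ZMod p),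
          (Y : Matrix (Fin 2) (Fin 2) (ZMod p)) = !![0, (1 : ZMod p); -1, 0] :=
        ⟨Matrix.GeneralLinearGroup.mkOfDetNeZero _ (by rw [Matrix.det_fin_two_of]; norm_num), rfl⟩
      refine key Y (Or.inr ⟨by simp [hYval], by simp [hYval]⟩) ?_ ?_
      · ext
        rw [Matrix.GeneralLinearGroup.val_det_apply, hYval, Matrix.det_fin_two_of, Units.val_one]
        ring
      · rw [Units.val_mul]
        simp only [Matrix.trace_fin_two, Matrix.mul_apply, Fin.sum_univ_two, hYval, Matrix.of_apply, Matrix.cons_val_zero,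
          Matrix.cons_val_one, hX00, hX11]
        intro h
        apply h1
        linear_combination h

end Summit.BirchSwinnertonDyer.BirchSwinnertonDyer.Theorems.AuxPrimeSupplyCorner

end
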